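import Mathlib
import Literature.MathematicalPhysics.QuantumFieldTheory.Balaban1983to89.B10Assembly

/-!
# BalabanUVNodes ∕ N08 — PER-RUN leaf systems do NOT give [Balaban1985UV3] Theorem 1's bounds (5), even in the compact reading: a
# `B10Assembly.LeafSystem`-carrying family with per-run large-field constants on which `B10.Thm2Printed` holds and `B10.Thm1PrintedCompact`
# fails (Track A, DAG node N08; cell `pub-ymgap`, R141 (C) fan-out seat `pub-ymgap-dag-n08-e`, FAN-OUT v1.1 §N08 row s3; `--supports` K1)

CITATION HEADER.  Source: T. Bałaban, *Ultraviolet stability of three-dimensional lattice pure gauge field theories*, Commun. Math. Phys.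
**102**, 255–275 (1985), doi:10.1007/bf01229380, bib `Balaban1985UV3` (cell paper B10; journal page = PDF page + 254).  Quotations: p. 256 [2]
(5) «χ(U)exp[−(1/g_k²)A^η(U_k(U)) − O(1)|T₁^{(k)}|] ≤ ρ_k(U) ≤ exp O(1)|T₁^{(k)}|» and p. 257 [3] L1 «and the constant O(1) is independent of ε, k,
g_k in a bounded set.»; Theorem 2 p. 272 [18] «The sequence of densities ρ_k defined by the inductive equations (2), with ρ₀ given by (1), satisfies
the inequalities (41), (47).»; Sect. D pp. 273–274 [19–20], after (66): «The analysis of Sect. 3.C [9], which is model independent, show that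
these small factors are enough to control all sums in (41), together with the second term in (65). This gives the upper bound in (5).» — the
large-field control whose O(1) the cell carries as the family constant `B10Assembly.Consts.d` (leaf `B10Assembly.LeafSystem.lf`, shape
`B10.LargeFieldControlPrinted`).

WHAT THIS MODULE DOES (FAN-OUT v1.1 §N08 row s3 «kernel witness that (5) is NOT automatic»; companion of
`Summits/QuantumFields/YangMills/Theorems/BalabanUVNodesN08RelativeTo5.lean`; value = a consistency statement about the TYPING, nothing about
Yang–Mills; Summits-side because the model and its theorems are the cell's own devices, not published statements).  The cell proves THE PAPER AS ONE IMPLICATION `B10Assembly.thm1Compact_and_thm2_of_leafSystem`: a family of runs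
carrying leaf systems with COMMON constants `C : B10Assembly.Consts` satisfies `B10.Thm1PrintedCompact ∧ B10.Thm2Printed`.  At NODE 00's record the
`b10` slot reads Thm 2 in the ∃-representation reading (`B10RunsOfRecord.Repr41_47G`: tower objects with SOME leaf system, constants quantified
PER RUN), which the companion module shows EQUIVALENT to per-run leaf-system data, so that the slot splits as «(5), compact reading» ∧ «per-run
data».  THIS module witnesses that the first conjunct is NOT a consequence of the second: the uniformity of the leaf constants across the family —
print's «O(1) independent of ε, k» — is exactly what (5) needs beyond Thm 2.

* §1 THE MODEL `lfRun d K` (d ∈ ℝ, depth K ∈ ℕ): the cell's trivial run `B10Assembly.trivRun K` (one configuration and one history per scale,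
  spacing 2^{−K}, all actions ∕ interactions ∕ counterterms ∕ Z-terms ∕ remainders 0, g_k = (2^k·2^{−K})^{1/2} ∈ (0, 1], |T₁^{(k)}| = (2^k·2^{−K})^{−3})
  with the history functional SCALED by the large-field factor, `LF_k(U, F) = e^{d|T₁^{(k)}|}·e^{F(·)}`, and `ρ_k ≡ e^{d|T₁^{(k)}|}` — so (41)_k holds
  with equality and (47)_k holds for `d ≥ 0` (`ineq41_lfRun`, `ineq47_lfRun`); it carries a leaf system for the constants `lfConsts d` = the
  cell's `trivConsts` with large-field constant `d` (`lfLeafSystem`; the leaf `lf` with equality).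
* §2 THE O(1) OF (5) ON THE MODEL IS AT LEAST `d` at every step (`le_of_bounds5At_lfRun`: `ρ_k = e^{d|T₁^{(k)}|} ≤ e^{O(1)|T₁^{(k)}|}` forces
  `d ≤ O(1)`), while `O(1) := d` serves (`bounds5At_lfRun`).
* §3 THE FAMILY `n ↦ lfRun n K` (n ∈ ℕ; SAME lattice data, per-run leaf constants `lfConsts n`): every run carries a leaf system, the couplings lie in
  (0, 1] with `g_K = 1`, `B10.Thm2Printed` holds (by `B10Assembly.thm2_of_leafSystem`, run by run) and **`B10.Thm1PrintedCompact` FAILS** (window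
  [1/2, 1] ∋ g_K: an O(1) serving all runs at step K would dominate every n) — `not_thm1Compact_lfFamily`; packaged: `perRunLeafSystems_separation`.
  Corollaries: «per-run leaf systems ⇒ Thm 1 (compact)» is FALSE (`not_thm1Compact_of_perRunLeafSystems`; contrast
  `B10Assembly.thm1Compact_of_leafSystem`, ONE `C`), and «`SpecOK` + couplings in (0, 1] + Thm 2 ⇒ Thm 1 (compact)» is FALSE
  (`not_thm1Compact_of_thm2Printed`; contrast `B10.thm1Compact_of_thm2`, whose four piece-bounds are assumed UNIFORM in the run).  With ONE `d`
  for the whole family (5) holds (`thm1Compact_lfFamily_const`): it is the non-uniformity, not the model, that breaks (5).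

WHAT IS NOT CLAIMED.  Nothing about Bałaban's densities or about whether the large-field constant of [9] Sect. 3.C is ε-uniform for them (the
audit question of the series at this leaf); the model is a bookkeeping device over the abstract carrier `B10.TowerRun`, exactly like
`B10Assembly.trivRun` and `B10DagLeaf.logRun`.  HONEST FRAMING: d = 3 finite tori of [B10]; nothing continuum ∕ ℝ⁴ ∕ OS ∕ mass gap ∕ Clay.
No `sorry`, no `axiom`, no `instance`, no `notation`.
-/

namespace Summit.QuantumFields.YangMills.Theorems.BalabanUVNodesN08LargeFieldConstFamily

open Literature.MathematicalPhysics.QuantumFieldTheory.Balaban1983to89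
open Literature.MathematicalPhysics.QuantumFieldTheory.Balaban1983to89.B10
open Literature.MathematicalPhysics.QuantumFieldTheory.Balaban1983to89.B10Assembly
open Literature.MathematicalPhysics.QuantumFieldTheory.Balaban1983to89.B10SectAGathering

/-! ## §1. The model run with large-field constant `d` and its leaf system -/

section Model

/-- Family constants of the model: the cell's `B10Assembly.trivConsts` (g = 1, L = 2, κ₀ = 1/4, p₀ = 1, every other O(1) = 0) except the
large-field constant `d ≥ 0` (the O(1) of pp. 273–274).  A bookkeeping device, nothing about gauge theory. [folklore] -/
noncomputable def lfConsts (d : ℝ) (hd : 0 ≤ d) : Consts :=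
  { trivConsts with d := d, d_nonneg := hd }

/-- The spacing of the depth-K model run: ε = 2^{−K}. [folklore] -/
noncomputable def lfEps (K : ℕ) : ℝ := ((2 : ℝ) ^ K)⁻¹

/-- Elementary: ε = 2^{−K} > 0. [folklore] -/
theorem lfEps_pos (K : ℕ) : 0 < lfEps K := by
  unfold lfEps; positivity

/-- **The model run of depth K with large-field constant `d`**: `B10Assembly.trivRun K` (one configuration and one history per scale, all
actions ∕ interactions ∕ counterterms ∕ Z-terms ∕ remainders 0, g_k = (2^kε)^{1/2}, |T₁^{(k)}| = (2^kε)^{−3}, ε = 2^{−K}) with the history functional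
scaled by the large-field factor, `LF_k(U, F) = exp(d|T₁^{(k)}|)·exp F(·)`, and **ρ_k ≡ exp(d|T₁^{(k)}|)**.  A consistency device for the typing.
[folklore] -/
noncomputable def lfRun (d : ℝ) (K : ℕ) : TowerRun where
  K := K
  Cfg := fun _ => Unit
  ρ := fun k _ => Real.exp (d * sitesRun 2 (lfEps K) 1 k)
  χ := fun _ _ => 1
  wilsonBG := fun _ _ => 0
  sites := sitesRun 2 (lfEps K) 1
  g := gRun 1 2 (lfEps K)
  Ineq41_47 := fun _ => True
  Hist := fun _ => Unit
  triv := fun _ => ()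
  LF := fun k _ F => Real.exp (d * sitesRun 2 (lfEps K) 1 k) * Real.exp (F ())
  lf_mono := fun _ _ F G hFG => mul_le_mul_of_nonneg_left (Real.exp_le_exp.mpr (hFG ())) (Real.exp_pos _).le
  lf_shift := fun k _ F t => by
    show Real.exp (d * sitesRun 2 (lfEps K) 1 k) * Real.exp (F () + t) =
      Real.exp t * (Real.exp (d * sitesRun 2 (lfEps K) 1 k) * Real.exp (F ()))
    rw [Real.exp_add]; ring
  mainT := fun _ _ _ => 0
  mainT_triv := fun _ _ => by simp
  Pint := fun _ _ _ => 0
  Λvol := fun _ _ => 0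
  Λvol_le := fun k _ => sitesRun_nonneg 2 _ 1 (by norm_num) (lfEps_pos K) zero_le_one k
  Zterm := fun _ _ => 0
  Zterm_triv := fun _ => rfl
  Ecst := fun _ => 0
  Estep := fun _ => 0
  Ecst_eq := fun _ => by simp
  Rm := fun _ => 0
  χ_nonneg := fun _ _ => zero_le_one
  sites_nonneg := fun k => sitesRun_nonneg 2 _ 1 (by norm_num) (lfEps_pos K) zero_le_one k
  M₁ := 0
  b₀ := 0
  p₀ := 1

variable (d : ℝ) (K : ℕ)

/-- The model's densities: `ρ_k ≡ exp(d|T₁^{(k)}|)` (`rfl`). [folklore] -/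
theorem lfRun_ρ (k : ℕ) (U : (lfRun d K).Cfg k) : (lfRun d K).ρ k U = Real.exp (d * (lfRun d K).sites k) := rfl

/-- The model's history functional: `LF_k(U, F) = exp(d|T₁^{(k)}|)·exp F(·)` (`rfl`). [folklore] -/
theorem lfRun_LF (k : ℕ) (U : (lfRun d K).Cfg k) (F : (lfRun d K).Hist k → ℝ) :
    (lfRun d K).LF k U F = Real.exp (d * (lfRun d K).sites k) * Real.exp (F ()) := rfl

/-- `|T₁^{(k)}| > 0` in the model. [folklore] -/
theorem lfRun_sites_pos (k : ℕ) : 0 < (lfRun d K).sites k := by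
  show 0 < sitesRun 2 (lfEps K) 1 k
  unfold sitesRun
  have := lfEps_pos K
  positivity

/-- At the top step the unit lattice has one site: `|T₁^{(K)}| = (2^K·2^{−K})^{−3} = 1`. [folklore] -/
theorem lfRun_sites_top : (lfRun d K).sites K = 1 := by
  show sitesRun 2 (lfEps K) 1 K = 1
  unfold sitesRun lfEps
  rw [mul_inv_cancel₀ (pow_ne_zero K two_ne_zero)]
  norm_num

/-- At the top step the coupling is the bare one: `g_K = (2^K·2^{−K})^{1/2} = 1`. [folklore] -/
theorem lfRun_g_top : (lfRun d K).g K = 1 := by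
  show gRun 1 2 (lfEps K) K = 1
  unfold gRun lfEps
  rw [mul_inv_cancel₀ (pow_ne_zero K two_ne_zero), Real.sqrt_one, one_mul]

/-- **(41)_k holds in the model, with equality**: `ρ_k = exp(d|T₁^{(k)}|) = LF_k(U, −A + 𝒫 − E_k + Z + R) ` (all exponent pieces 0). [folklore] -/
theorem ineq41_lfRun (k : ℕ) : Ineq41 (lfRun d K) k := by
  intro U
  show Real.exp (d * sitesRun 2 (lfEps K) 1 k) ≤
    Real.exp (d * sitesRun 2 (lfEps K) 1 k) * Real.exp (-(0 : ℝ) + 0 - 0 + 0 + 0)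
  simp

variable {d} in
/-- **(47)_k holds in the model** for `d ≥ 0`: `χ_k·exp(−A + 𝒫 − E_k − R) = 1 ≤ exp(d|T₁^{(k)}|) = ρ_k`. [folklore] -/
theorem ineq47_lfRun (hd : 0 ≤ d) (k : ℕ) : Ineq47 (lfRun d K) k := by
  intro U
  show (1 : ℝ) * Real.exp (-(0 : ℝ) + 0 - 0 - 0) ≤ Real.exp (d * sitesRun 2 (lfEps K) 1 k)
  have hs : 0 ≤ d * sitesRun 2 (lfEps K) 1 k := mul_nonneg hd ((lfRun d K).sites_nonneg k)
  have h1 : (1 : ℝ) * Real.exp (-(0 : ℝ) + 0 - 0 - 0) = 1 := by simp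
  rw [h1]
  linarith [Real.add_one_le_exp (d * sitesRun 2 (lfEps K) 1 k)]

/-- The step pieces of the model: everything 0 (no starred bonds, no σ₀, no Z, no vacuum terms), the remainder unit the carrier's
(2^kε)^{3+¼}|T₁^{(k)}|. [folklore] -/
noncomputable def lfPieces (k : ℕ) : StepPieces (lfRun d K) k where
  proj := fun _ => ()
  proj_triv := rfl
  Zvol := fun _ => 0
  Zvol_nonneg := fun _ => le_rfl
  Zvol_triv := rfl
  starB := fun _ => 0
  starT := 0
  logσ₀ := 0
  dg := 0
  dg_nonneg := le_rfl
  logZU := fun _ _ => 0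
  logZ1 := fun _ => 0
  logZT := 0
  logFl := fun _ _ => 0
  PprU := fun _ _ => 0
  Ppr1 := fun _ => 0
  PprT := 0
  PY := fun _ _ => 0
  PYZ := fun _ _ => 0
  Pold := fun _ _ => 0
  PoldIn := fun _ _ => 0
  rem := ((2 : ℝ) ^ k * lfEps K) ^ ((3 : ℝ) + 1 / 4) * sitesRun 2 (lfEps K) 1 k
  rem_nonneg := mul_nonneg (Real.rpow_nonneg (by have := lfEps_pos K; positivity) _)
    (sitesRun_nonneg 2 _ 1 (by norm_num) (lfEps_pos K) zero_le_one k)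

variable {d} in
/-- The fourteen step leaves hold in the model at every step, all constants 0 (`d ≥ 0` for the lower bound (55)′: `1 ≤ ρ_{k+1}`). [folklore] -/
noncomputable def lfLeaves (hd : 0 ≤ d) (k : ℕ) : StepLeaves (lfRun d K) k where
  P := lfPieces d K k
  Cz := 0
  C₁ := 0
  C₁' := 0
  C₂ := 0
  Cv := 0
  C₃ := 0
  C₄ := 0
  C₅ := 0
  c₁ := 0
  C₆ := 0
  bound55 := fun _ U => by
    show Real.exp (d * sitesRun 2 (lfEps K) 1 (k + 1)) ≤
      Real.exp (d * sitesRun 2 (lfEps K) 1 (k + 1)) *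
        Real.exp (-(0 : ℝ) - 0 + ((0 : ℝ) + 0 * Real.log (gRun 1 2 (lfEps K) k)) * 0 + 0 + 0 + 0 + 0 + 0)
    simp
  bound55Lower := fun _ U => by
    show (1 : ℝ) * Real.exp (-(0 : ℝ) - 0 + ((0 : ℝ) + 0 * Real.log (gRun 1 2 (lfEps K) k)) * 0 + 0 + 0 - 0 + 0) ≤
      Real.exp (d * sitesRun 2 (lfEps K) 1 (k + 1))
    have hs : 0 ≤ d * sitesRun 2 (lfEps K) 1 (k + 1) := mul_nonneg hd ((lfRun d K).sites_nonneg (k + 1))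
    have h1 : (1 : ℝ) * Real.exp (-(0 : ℝ) - 0 + ((0 : ℝ) + 0 * Real.log (gRun 1 2 (lfEps K) k)) * 0 + 0 + 0 - 0 + 0) = 1 := by
      simp
    rw [h1]
    linarith [Real.add_one_le_exp (d * sitesRun 2 (lfEps K) 1 (k + 1))]
  cumulant58 := fun h U => by simp [lfRun, lfPieces]
  cumulantLower := fun U => by simp [lfRun, lfPieces]
  repr33_60 := fun h U => by simp [lfPieces]
  vacuumWhole := fun h => by simp [lfRun, lfPieces]
  decomp35_61 := fun h U => by simp [lfPieces]
  norm35 := fun h => by simp [lfPieces]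
  starCount := fun h => by simp [lfPieces]
  oldOutside := fun h U => by simp [lfPieces]
  pintSucc := fun h U => by simp [lfRun, lfPieces]
  estep62 := by simp [Estep62, lfRun, lfPieces]
  ztermSucc := fun h => by simp [lfRun, lfPieces]
  rmSucc := by simp [RmSucc, lfRun, lfPieces]

/-- Elementary: `2^k·2^{−K} ≤ 1` for k ≤ K (`B10Assembly.two_pow_mul_inv_le_one` on `lfEps`). [folklore] -/
theorem scale_le_one_lf {K k : ℕ} (hk : k ≤ K) : (2 : ℝ) ^ k * lfEps K ≤ 1 :=
  two_pow_mul_inv_le_one hk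

variable {d} in
/-- **THE MODEL RUN CARRIES A LEAF SYSTEM for the constants `lfConsts d` (large-field constant `d`), at every depth K**: the large-field leaf `lf`
holds with equality, `LF_k(U, −A + Z) = exp(d|T₁^{(k)}|)`; every other leaf as for the cell's `trivLeafSystem`. [folklore] -/
noncomputable def lfLeafSystem (hd : 0 ≤ d) (K : ℕ) : LeafSystem (lfConsts d hd) (lfRun d K) where
  ε := lfEps K
  Tε := 1
  ε_pos := lfEps_pos K
  Tε_nonneg := zero_le_one
  g_eq := fun _ => rfl
  sites_eq := fun _ => rfl
  scale_le_one := fun k hk => scale_le_one_lf hk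
  g_le_one := fun k hk => by
    show 1 * Real.sqrt ((2 : ℝ) ^ k * lfEps K) ≤ 1
    rw [one_mul]
    calc Real.sqrt ((2 : ℝ) ^ k * lfEps K) ≤ Real.sqrt 1 := Real.sqrt_le_sqrt (scale_le_one_lf hk)
      _ = 1 := Real.sqrt_one
  par := ⟨rfl, rfl, rfl⟩
  spec := fun k => ⟨fun _ => ⟨ineq41_lfRun d K k, ineq47_lfRun K hd k⟩, fun _ => trivial⟩
  step0 := ⟨ineq41_lfRun d K 0, ineq47_lfRun K hd 0⟩
  noInt0 := fun _ _ => rfl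
  steps := fun k _ => lfLeaves K hd k
  Λvol_nonneg := fun _ _ => le_rfl
  bound46 := fun k _ _ h U => by simp [lfRun, lfConsts, trivConsts]
  starT_nonneg := fun _ _ => le_rfl
  starT_le := fun k _ => by
    show (0 : ℝ) ≤ 3 * (lfRun d K).sites k
    exact mul_nonneg (by norm_num) ((lfRun d K).sites_nonneg k)
  logσ₀_le := fun _ _ => by simp [lfPieces, lfLeaves, lfConsts, trivConsts]
  dg_le := fun _ _ => by
    show (0 : ℝ) ≤ 0
    exact le_rfl
  logZT_le := fun _ _ => by simp [lfPieces, lfLeaves, lfConsts, trivConsts]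
  PprT_le := fun _ _ => by simp [lfPieces, lfLeaves, lfConsts, trivConsts]
  rem_eq := fun k _ => by
    show ((2 : ℝ) ^ k * lfEps K) ^ ((3 : ℝ) + 1 / 4) * sitesRun 2 (lfEps K) 1 k = _
    rfl
  Rm_zero := le_rfl
  Rm_succ_le := fun k _ => by simp [lfRun, lfConsts, trivConsts]
  lf := fun k _ U => by
    show Real.exp (d * sitesRun 2 (lfEps K) 1 k) * Real.exp (-(0 : ℝ) + 0) ≤ Real.exp (d * sitesRun 2 (lfEps K) 1 k)
    simp

variable {d} in
/-- The leaf system of the model is inhabited (for `d ≥ 0`, every depth). [folklore] -/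
theorem lfLeafSystem_nonempty (hd : 0 ≤ d) (K : ℕ) : Nonempty (LeafSystem (lfConsts d hd) (lfRun d K)) :=
  ⟨lfLeafSystem hd K⟩

variable {d} in
/-- The couplings of the model lie in (0, 1]: `0 < g_k ≤ 1` for `k ≤ K`. [folklore] -/
theorem lfRun_g_mem (hd : 0 ≤ d) (k : ℕ) (hk : k ≤ K) : 0 < (lfRun d K).g k ∧ (lfRun d K).g k ≤ 1 :=
  ⟨(lfLeafSystem hd K).g_pos k, (lfLeafSystem hd K).g_le_one k hk⟩

variable {d} in
/-- The slot binding `B10.SpecOK` holds for the model (field `spec` of its leaf system). [folklore] -/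
theorem lfRun_specOK (hd : 0 ≤ d) : SpecOK (lfRun d K) :=
  (lfLeafSystem hd K).spec

end Model

/-! ## §2. The O(1) of (5) on the model is pinned at the large-field constant -/

section Bounds5

variable {d : ℝ} (K : ℕ)

/-- **ANY constant O(1) serving the bounds (5) at step k of the model is ≥ `d`**: the upper half of (5) at the single configuration reads
`exp(d|T₁^{(k)}|) ≤ exp(O(1)|T₁^{(k)}|)` with `|T₁^{(k)}| > 0`.  Re-derived bookkeeping. [cite: Balaban1985UV3, (5) p.256] -/
theorem le_of_bounds5At_lfRun {O1 : ℝ} (k : ℕ) (h5 : Bounds5At (lfRun d K).toRunData O1 k) : d ≤ O1 := by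
  have hup : Real.exp (d * (lfRun d K).sites k) ≤ Real.exp (O1 * (lfRun d K).sites k) := (h5 ()).2
  exact le_of_mul_le_mul_right (Real.exp_le_exp.mp hup) (lfRun_sites_pos d K k)

/-- … and `O(1) := d` serves (5) at every step of the model (`d ≥ 0`; lower half: `1·exp(−0 − d|T|) ≤ exp(d|T|)`). [cite: Balaban1985UV3, (5) p.256] -/
theorem bounds5At_lfRun (hd : 0 ≤ d) (k : ℕ) : Bounds5At (lfRun d K).toRunData d k := by
  intro U
  have hs : 0 ≤ d * (lfRun d K).sites k := mul_nonneg hd ((lfRun d K).sites_nonneg k)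
  refine ⟨?_, le_rfl⟩
  show (1 : ℝ) * Real.exp (-(((lfRun d K).g k)⁻¹ ^ 2 * 0) - d * (lfRun d K).sites k) ≤ Real.exp (d * (lfRun d K).sites k)
  rw [one_mul, mul_zero, neg_zero, zero_sub]
  exact Real.exp_le_exp.mpr (by linarith)

/-- Hence on the model the O(1) of (5) is EXACTLY the large-field constant: `Bounds5At (lfRun d K) O1 k ↔ d ≤ O1` (`d ≥ 0`). [cite: Balaban1985UV3, (5) p.256] -/
theorem bounds5At_lfRun_iff (hd : 0 ≤ d) (k : ℕ) {O1 : ℝ} : Bounds5At (lfRun d K).toRunData O1 k ↔ d ≤ O1 := by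
  refine ⟨le_of_bounds5At_lfRun K k, fun h U => ?_⟩
  obtain ⟨hlo, hhi⟩ := bounds5At_lfRun K hd k U
  have hs : 0 ≤ (lfRun d K).sites k := (lfRun d K).sites_nonneg k
  refine ⟨le_trans ?_ hlo, hhi.trans (Real.exp_le_exp.mpr (mul_le_mul_of_nonneg_right h hs))⟩
  apply mul_le_mul_of_nonneg_left _ ((lfRun d K).χ_nonneg k U)
  exact Real.exp_le_exp.mpr (by nlinarith)

end Bounds5

/-! ## §3. The family with per-run large-field constants: Thm 2 holds, Thm 1 (compact reading) fails -/

section Family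

/-- **The per-run family**: run `n ∈ ℕ` is the model of depth K with large-field constant `n` (same lattice data for every run; the leaf
constants `lfConsts n` vary with the run). [folklore] -/
noncomputable def lfFamily (K : ℕ) (n : ℕ) : TowerRun := lfRun n K

variable (K : ℕ)

/-- Every run of the family carries a leaf system — for ITS OWN constants `lfConsts n`. [folklore] -/
theorem lfFamily_leafSystem (n : ℕ) : Nonempty (LeafSystem (lfConsts n n.cast_nonneg) (lfFamily K n)) :=
  lfLeafSystem_nonempty n.cast_nonneg K

/-- The couplings of the family lie in (0, 1]. [folklore] -/
theorem lfFamily_g_mem (n k : ℕ) (hk : k ≤ (lfFamily K n).K) : 0 < (lfFamily K n).g k ∧ (lfFamily K n).g k ≤ 1 :=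
  lfRun_g_mem K n.cast_nonneg k hk

/-- The slot binding holds along the family. [folklore] -/
theorem lfFamily_specOK (n : ℕ) : SpecOK (lfFamily K n) :=
  lfRun_specOK K n.cast_nonneg

/-- **THEOREM 2 HOLDS ON THE FAMILY** — run by run from its leaf system (`B10Assembly.thm2_of_leafSystem` on the one-member family), i.e. by
the printed route (1)₀ + step leaves ⇒ (41)_k ∧ (47)_k, not by fiat. [cite: Balaban1985UV3, Thm 2 p.272] -/
theorem thm2Printed_lfFamily : Thm2Printed (fun n : ℕ => (lfFamily K n).toRunData) :=
  fun n => thm2_of_leafSystem (fun _ : Unit => lfFamily K n) (fun _ => lfLeafSystem n.cast_nonneg K) ()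

/-- … with (41)_k ∧ (47)_k in their typed shapes at every step. [cite: Balaban1985UV3, (41) p.266 + (47) p.267] -/
theorem ineq41_47_lfFamily (n k : ℕ) : Ineq41 (lfFamily K n) k ∧ Ineq47 (lfFamily K n) k :=
  ⟨ineq41_lfRun n K k, ineq47_lfRun K n.cast_nonneg k⟩

/-- **THEOREM 1 IN THE COMPACT READING FAILS ON THE FAMILY**: in the window [1/2, 1] (which contains `g_K = 1` of every run) no single O(1)
serves all runs at step K, since run `n` forces `O(1) ≥ n` (`le_of_bounds5At_lfRun`).  So per-run leaf systems — with the large-field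
constant free per run — do not deliver (5): the uniformity «O(1) independent of ε, k» (p. 257 L1) is an input on the leaf constants, not a
consequence of Theorem 2. [cite: Balaban1985UV3, Thm 1 p.257, (5) p.256] -/
theorem not_thm1Compact_lfFamily : ¬ Thm1PrintedCompact (fun n : ℕ => (lfFamily K n).toRunData) := by
  intro h
  obtain ⟨O1, hO1⟩ := h (1 / 2) 1 (by norm_num) (by norm_num)
  obtain ⟨n, hn⟩ := exists_nat_gt O1
  have hg : (lfFamily K n).g K = 1 := lfRun_g_top n K
  have h5 : Bounds5At (lfFamily K n).toRunData O1 K :=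
    hO1 n K le_rfl (by show (1 : ℝ) / 2 ≤ (lfFamily K n).g K; rw [hg]; norm_num)
      (by show (lfFamily K n).g K ≤ 1; rw [hg])
  have hle : (n : ℝ) ≤ O1 := le_of_bounds5At_lfRun K K h5
  linarith

/-- **THE SEPARATION, PACKAGED**: there is a family of tower runs, EACH carrying a leaf system (for per-run constants), with couplings in (0, 1],
on which `B10.Thm2Printed` holds and `B10.Thm1PrintedCompact` fails.  Contrast `B10Assembly.thm1Compact_and_thm2_of_leafSystem` (ONE `C` for the
family ⇒ both).  A statement about the TYPING. [folklore] -/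
theorem perRunLeafSystems_separation :
    ∃ (I : Type) (T : I → TowerRun) (C : I → B10Assembly.Consts),
      (∀ i, Nonempty (LeafSystem (C i) (T i))) ∧ (∀ i k, k ≤ (T i).K → 0 < (T i).g k ∧ (T i).g k ≤ 1)
        ∧ Thm2Printed (fun i => (T i).toRunData) ∧ ¬ Thm1PrintedCompact (fun i => (T i).toRunData) :=
  ⟨ℕ, lfFamily 0, fun n => lfConsts n n.cast_nonneg, lfFamily_leafSystem 0, lfFamily_g_mem 0, thm2Printed_lfFamily 0,
    not_thm1Compact_lfFamily 0⟩

/-- Corollary: «a family of runs each carrying a leaf system (constants per run) satisfies Theorem 1 in the compact reading» is FALSE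
(contrast `B10Assembly.thm1Compact_of_leafSystem`: true for COMMON constants). [folklore] -/
theorem not_thm1Compact_of_perRunLeafSystems :
    ¬ ∀ (I : Type) (T : I → TowerRun) (C : I → B10Assembly.Consts), (∀ i, LeafSystem (C i) (T i)) →
        Thm1PrintedCompact (fun i => (T i).toRunData) :=
  fun h => not_thm1Compact_lfFamily 0 (h ℕ (lfFamily 0) (fun n => lfConsts n n.cast_nonneg) fun n => lfLeafSystem n.cast_nonneg 0)

/-- Corollary: «`SpecOK` + couplings in (0, 1] + Theorem 2 ⇒ Theorem 1 (compact reading)» is FALSE over the carrier — the Sect. D leaf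
`B10.Thm1OfThm2Leaf` ∕ `B10.thm1Compact_of_thm2` genuinely needs its four piece-bounds UNIFORM in the run. [folklore] -/
theorem not_thm1Compact_of_thm2Printed :
    ¬ ∀ (I : Type) (T : I → TowerRun), (∀ i, SpecOK (T i)) → (∀ i k, k ≤ (T i).K → 0 < (T i).g k ∧ (T i).g k ≤ 1) →
        Thm2Printed (fun i => (T i).toRunData) → Thm1PrintedCompact (fun i => (T i).toRunData) :=
  fun h => not_thm1Compact_lfFamily 0 (h ℕ (lfFamily 0) (lfFamily_specOK 0) (lfFamily_g_mem 0) (thm2Printed_lfFamily 0))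

/-- **With ONE large-field constant for the whole family (5) HOLDS** (the cell's assembly theorem on the constant family `n ↦ lfRun d K`, common
constants `lfConsts d`): it is the non-uniformity of `d` across runs, not the model, that breaks Theorem 1. [cite: Balaban1985UV3, Thm 1 p.257] -/
theorem thm1Compact_lfFamily_const {d : ℝ} (hd : 0 ≤ d) (K : ℕ) :
    Thm1PrintedCompact (fun _ : ℕ => (lfRun d K).toRunData) ∧ Thm2Printed (fun _ : ℕ => (lfRun d K).toRunData) :=
  thm1Compact_and_thm2_of_leafSystem (fun _ : ℕ => lfRun d K) fun _ => lfLeafSystem hd K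

end Family

end Summit.QuantumFields.YangMills.Theorems.BalabanUVNodesN08LargeFieldConstFamily
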